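import Mathlib
import Summits.CriticalPhenomena.CardyFormulaZ2.Theorems.CardyMagicRigidityDefs
import Summits.CriticalPhenomena.CardyFormulaZ2.Theorems.CardyMagicRigidityPositiveConeDefs
import Literature.Probability.RandomPlanarGeometry.LoopConfigurations
import Literature.Probability.RandomPlanarGeometry.LoopWinding
import Literature.Probability.RandomPlanarGeometry.LocFinLoopConfig
import HarnessLib

/-!
# Stub `stub_treeRigidity`: two-loop configurations for the family-switch witness

Crux `Summit.CriticalPhenomena.CardyFormulaZ2.Theses.CardyMagicRigidity.NestingRigidity`
(stmt-CriticalPhenomena-4835), line `positive-cone-weight-doubling`, registered stub `stub_treeRigidity`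
(= `TreeRigidity`: doubly convergent REGULAR limits + `NestingLawAgreement` ⇒ `d_CN(bond, site) → 0`).
`NestingLawAgreement` gives, disc family by disc family, asymptotic agreement of the joint law of the
pattern counts `(N_S)_{S ≠ ∅}` of ONE family `(x, r, R)`; the reconstruction step (2) of the route needs
the JOINT law of counts of SEVERAL families (one- and two-disc surround counts at all rational data,
`…TransferRigidity`).  The companion file `…TreeRigidityFamilySwitch` shows that this gap is real: two
laws on surely `Regular` two-loop configurations with the same single-family count laws for EVERY family
and different two-family laws, at coupling distance `≥ 1/2`.  This file is its deterministic,
construction-free part, for abstract loops given by their traces and winding interiors: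

* §1 `regular_of_loops_eq_pair` (registered anchor) — a configuration whose loops are two degree-`{0,1}`
  loops with the boundary property and NESTED, DISTINCT winding interiors, all of type `0`, is `Regular`;
  `frontier_ball_diff` — the frontier of a slit disc `B(c, ρ) ∖ N` (`N ⊆ B̄(c, ρ)` closed with empty
  interior) is `sphere c ρ ∪ N`: the boundary property of a "needled" circle loop.
* §2 `patternCount_pair` — the pattern count of a two-loop configuration is the sum of the two
  indicator counts; `not_patternClauses_of_needle` — a loop whose trace contains a set `ν` missed by its
  interior is counted by NO pattern count of a family one of whose closed discs meets `ν` (the disc is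
  neither surrounded nor avoided: the loop "cuts" it and is invisible); `patternClauses_iff_of_needle` —
  a loop `a'` obtained from `a` by adding such a needle `ν ⊆ int a ∪ trace a` inside the window of `a` is
  counted exactly like `a` by every family all of whose discs miss `ν`;
  `patternCount_switch` — hence for loops `a, a', b, b'` with `ν ⊆ trace a' ∩ trace b ∩ trace b'` the
  SWITCH IDENTITY: for every family, either `N_S{a,b} = N_S{a,b'}` and `N_S{a',b'} = N_S{a',b}` for all
  `S` (a disc meets `ν`), or `N_S{a,b} = N_S{a',b}` and `N_S{a',b'} = N_S{a,b'}` for all `S` (no disc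
  does) — so the uniform mixtures of `{a,b}, {a',b'}` and of `{a,b'}, {a',b}` have the same law of
  `(N_S)_S` for every single family.
* §3 `le_udist_of_forall_le_dist`, `not_isClose_of_far`, `le_cnLawEDist_of_forall_not_isClose`,
  `volume_setOf_ite_lt_half` — the generic distance and measure bookkeeping of the witness.
-/

noncomputable section

open MeasureTheory Set Filter Metric
open scoped Real Topology BigOperators ENNReal

namespace Summit.CriticalPhenomena.CardyFormulaZ2.Cruxes.NestingRigidity.PositiveConeWeightDoubling

open Literature.Probability.RandomPlanarGeometry
open Summit.CriticalPhenomena.CardyFormulaZ2.Cruxes.NestingRigidity.RingCloudTomography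

/-! ## §1 Two-loop configurations: regularity; slit discs -/

/-- The loops of the configuration `{u, v}` of type `0`. -/
theorem loops_pairConfig (u v : UnbasedLoop ℂ) :
    (⟨fun j ↦ if j = 0 then {u, v} else ∅⟩ : LoopConfig ℂ).loops = {u, v} := by
  simp [LoopConfig.loops]

/-- **Two nested regular loops form a `Regular` configuration (registered anchor).**  If the loops of a
configuration are `u` and `v`, all of type `0`, both of covering degree `{0, 1}` with trace = frontier of
the winding interior, and the interior of `v` is contained in, and different from, that of `u`, then the
configuration is `Regular` (locally finite: finitely many loops; laminar: nested; separating: the two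
interiors differ). -/
theorem regular_of_loops_eq_pair : ∀ (c : LoopConfig ℂ) (u v : UnbasedLoop ℂ), c.F 0 = {u, v} →
    c.F 1 = ∅ → (∀ z, u.wind z = 0 ∨ u.wind z = 1) → (∀ z, v.wind z = 0 ∨ v.wind z = 1) →
    u.range = frontier {z | u.wind z ≠ 0} → v.range = frontier {z | v.wind z ≠ 0} →
    {z | v.wind z ≠ 0} ⊆ {z | u.wind z ≠ 0} → {z | u.wind z ≠ 0} ≠ {z | v.wind z ≠ 0} → Regular c := by
  intro c u v h0 h1 hu1 hv1 hub hvb hnest hne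
  have hloops : c.loops = {u, v} := by rw [LoopConfig.loops, h0, h1, Set.union_empty]
  have hmem : ∀ w ∈ c.loops, w = u ∨ w = v := fun w hw ↦ by simpa [hloops] using hw
  refine ⟨?_, fun w hw z ↦ ?_, fun w hw ↦ ?_, fun w hw w' hw' ↦ ?_, fun w hw w' hw' heq ↦ ?_⟩
  · refine LoopConfig.IsLocallyFinite.of_finite fun i ↦ ?_
    fin_cases i
    · simp [h0]
    · simp [h1]
  · rcases hmem w hw with rfl | rfl
    · rcases hu1 z with h | h <;> simp [h]
    · rcases hv1 z with h | h <;> simp [h]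
  · rcases hmem w hw with rfl | rfl
    exacts [hub, hvb]
  · rcases hmem w hw with rfl | rfl <;> rcases hmem w' hw' with rfl | rfl
    · exact Or.inl subset_rfl
    · exact Or.inr (Or.inl hnest)
    · exact Or.inl hnest
    · exact Or.inl subset_rfl
  · rcases hmem w hw with rfl | rfl <;> rcases hmem w' hw' with rfl | rfl
    · exact Or.inl rfl
    · exact absurd heq hne
    · exact absurd heq.symm hne
    · exact Or.inl rfl

/-- **Frontier of a slit disc.**  If `N ⊆ B̄(c, ρ)` (`ρ > 0`) is closed with empty interior, then
`frontier (B(c, ρ) ∖ N) = sphere c ρ ∪ N`: the slit open disc is open and dense in the closed disc. -/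
theorem frontier_ball_diff {c : ℂ} {ρ : ℝ} (hρ : 0 < ρ) {N : Set ℂ} (hN : IsClosed N)
    (hNi : interior N = ∅) (hNsub : N ⊆ closedBall c ρ) : frontier (ball c ρ \ N) = sphere c ρ ∪ N := by
  have hopen : IsOpen (ball c ρ \ N) := isOpen_ball.sdiff hN
  have hdense : Dense Nᶜ := interior_eq_empty_iff_dense_compl.1 hNi
  have hclos : closure (ball c ρ \ N) = closedBall c ρ := by
    refine Subset.antisymm ?_ ?_
    · rw [← closure_ball c hρ.ne']
      exact closure_mono sdiff_subset
    · rw [← closure_ball c hρ.ne']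
      refine closure_minimal ?_ isClosed_closure
      exact hdense.open_subset_closure_inter isOpen_ball
  rw [frontier, hclos, hopen.interior_eq, sdiff_sdiff_right, closedBall_sdiff_ball,
    inter_eq_right.2 hNsub]

/-! ## §2 Pattern counts of two-loop configurations; needles; the switch identity -/

/-- The number of elements of `{u, v}` (`u ≠ v`) satisfying a predicate is the sum of two indicators. -/
theorem ncard_pair_sep {u v : UnbasedLoop ℂ} (huv : u ≠ v) (p : UnbasedLoop ℂ → Prop)
    [DecidablePred p] :
    {w ∈ ({u, v} : Set (UnbasedLoop ℂ)) | p w}.ncard = (if p u then 1 else 0) + (if p v then 1 else 0) := by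
  by_cases hu : p u <;> by_cases hv : p v
  · rw [if_pos hu, if_pos hv, show {w ∈ ({u, v} : Set (UnbasedLoop ℂ)) | p w} = {u, v} from
      Set.ext fun w ↦ ⟨fun h ↦ h.1, fun h ↦ ⟨h, by rcases h with rfl | rfl <;> assumption⟩⟩]
    exact ncard_pair huv
  · rw [if_pos hu, if_neg hv, show {w ∈ ({u, v} : Set (UnbasedLoop ℂ)) | p w} = {u} from
      Set.ext fun w ↦ ⟨fun h ↦ by
        rcases h.1 with rfl | rfl
        · rfl
        · exact absurd h.2 hv, fun h ↦ ⟨Or.inl h, by rw [mem_singleton_iff.1 h]; exact hu⟩⟩]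
    exact ncard_singleton u
  · rw [if_neg hu, if_pos hv, show {w ∈ ({u, v} : Set (UnbasedLoop ℂ)) | p w} = {v} from
      Set.ext fun w ↦ ⟨fun h ↦ by
        rcases h.1 with rfl | rfl
        · exact absurd h.2 hu
        · rfl, fun h ↦ ⟨Or.inr h, by rw [mem_singleton_iff.1 h]; exact hv⟩⟩]
    exact ncard_singleton v
  · rw [if_neg hu, if_neg hv, show {w ∈ ({u, v} : Set (UnbasedLoop ℂ)) | p w} = ∅ from
      Set.eq_empty_of_forall_notMem fun w h ↦ by
        rcases h.1 with rfl | rfl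
        exacts [hu h.2, hv h.2]]
    exact ncard_empty _

open Classical in
/-- **Pattern counts of a two-loop configuration** `{u, v}` (`u ≠ v`, type `0`): the sum of the indicators
that `u`, resp. `v`, is counted. -/
theorem patternCount_pair {u v : UnbasedLoop ℂ} (huv : u ≠ v) {n : ℕ} (x : Fin n → ℂ) (r : Fin n → ℝ)
    (R : ℝ) (S : Finset (Fin n)) :
    patternCount (⟨fun j ↦ if j = 0 then {u, v} else ∅⟩ : LoopConfig ℂ) x r R S =
      (if u.range ⊆ ball (0 : ℂ) R ∧ (∀ i ∈ S, closedBall (x i) (r i) ⊆ {w | u.wind w ≠ 0}) ∧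
          ∀ i, i ∉ S → Disjoint (closedBall (x i) (r i)) ({w | u.wind w ≠ 0} ∪ u.range) then 1 else 0) +
      (if v.range ⊆ ball (0 : ℂ) R ∧ (∀ i ∈ S, closedBall (x i) (r i) ⊆ {w | v.wind w ≠ 0}) ∧
          ∀ i, i ∉ S → Disjoint (closedBall (x i) (r i)) ({w | v.wind w ≠ 0} ∪ v.range) then 1 else 0) := by
  unfold patternCount
  rw [loops_pairConfig]
  exact ncard_pair_sep huv _

/-- **Needled loops are invisible to families meeting the needle.**  If the trace of `u` contains a set
`ν` disjoint from its winding interior, then no pattern count of a disc family one of whose closed discs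
meets `ν` counts `u`: that disc is neither surrounded (it meets `ν ⊆ {W = 0}`) nor avoided (it meets the
trace). -/
theorem not_patternClauses_of_needle {u : UnbasedLoop ℂ} {ν : Set ℂ} (hνr : ν ⊆ u.range)
    (hνi : Disjoint ν {w | u.wind w ≠ 0}) {n : ℕ} {x : Fin n → ℂ} {r : Fin n → ℝ} {i : Fin n}
    (hi : ¬ Disjoint (closedBall (x i) (r i)) ν) (R : ℝ) (S : Finset (Fin n)) :
    ¬ (u.range ⊆ ball (0 : ℂ) R ∧ (∀ i ∈ S, closedBall (x i) (r i) ⊆ {w | u.wind w ≠ 0}) ∧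
        ∀ i, i ∉ S → Disjoint (closedBall (x i) (r i)) ({w | u.wind w ≠ 0} ∪ u.range)) := by
  rintro ⟨-, hsur, hav⟩
  obtain ⟨z, hzD, hzν⟩ := Set.not_disjoint_iff.1 hi
  by_cases hiS : i ∈ S
  · exact Set.disjoint_left.1 hνi hzν (hsur i hiS hzD)
  · exact Set.disjoint_left.1 (hav i hiS) hzD (Or.inr (hνr hzν))

/-- **Adding a needle inside the window does not change the counts of families missing it.**  Let `a'`
be obtained from `a` by adding a needle `ν`: `trace a' = trace a ∪ ν`, `int a' = int a ∖ ν`, with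
`ν ⊆ int a ∪ trace a` and `ν` inside every window containing `trace a`.  Then `a` and `a'` satisfy the
same pattern clauses for every family all of whose closed discs miss `ν`. -/
theorem patternClauses_iff_of_needle {a a' : UnbasedLoop ℂ} {ν : Set ℂ} (hr : a'.range = a.range ∪ ν)
    (hi : {w | a'.wind w ≠ 0} = {w | a.wind w ≠ 0} \ ν) (hν : ν ⊆ {w | a.wind w ≠ 0} ∪ a.range)
    (hwin : ∀ R : ℝ, a.range ⊆ ball (0 : ℂ) R → ν ⊆ ball (0 : ℂ) R) {n : ℕ} {x : Fin n → ℂ}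
    {r : Fin n → ℝ} (hmiss : ∀ i, Disjoint (closedBall (x i) (r i)) ν) (R : ℝ) (S : Finset (Fin n)) :
    (a'.range ⊆ ball (0 : ℂ) R ∧ (∀ i ∈ S, closedBall (x i) (r i) ⊆ {w | a'.wind w ≠ 0}) ∧
        ∀ i, i ∉ S → Disjoint (closedBall (x i) (r i)) ({w | a'.wind w ≠ 0} ∪ a'.range)) ↔
      (a.range ⊆ ball (0 : ℂ) R ∧ (∀ i ∈ S, closedBall (x i) (r i) ⊆ {w | a.wind w ≠ 0}) ∧
        ∀ i, i ∉ S → Disjoint (closedBall (x i) (r i)) ({w | a.wind w ≠ 0} ∪ a.range)) := by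
  have hunion : {w | a'.wind w ≠ 0} ∪ a'.range = {w | a.wind w ≠ 0} ∪ a.range := by
    rw [hi, hr]
    refine Subset.antisymm ?_ ?_
    · rintro w (hw | hw | hw)
      exacts [Or.inl hw.1, Or.inr hw, hν hw]
    · rintro w (hw | hw)
      · by_cases hwν : w ∈ ν
        · exact Or.inr (Or.inr hwν)
        · exact Or.inl ⟨hw, hwν⟩
      · exact Or.inr (Or.inl hw)
  have hwindow : a'.range ⊆ ball (0 : ℂ) R ↔ a.range ⊆ ball (0 : ℂ) R := by
    rw [hr, Set.union_subset_iff]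
    exact ⟨fun h ↦ h.1, fun h ↦ ⟨h, hwin R h⟩⟩
  have hsur : ∀ i, closedBall (x i) (r i) ⊆ {w | a'.wind w ≠ 0} ↔
      closedBall (x i) (r i) ⊆ {w | a.wind w ≠ 0} := fun i ↦ by
    rw [hi, Set.subset_sdiff]
    exact ⟨fun h ↦ h.1, fun h ↦ ⟨h, hmiss i⟩⟩
  rw [hwindow, hunion]
  simp only [hsur]

open Classical in
/-- **The switch identity.**  Let `a, a', b, b'` be pairwise distinct across the two letters, let `a'` be
`a` with a needle `ν` added (as in `patternClauses_iff_of_needle`), and let `ν` be contained in the traces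
of `a'`, `b`, `b'` and missed by their interiors.  Then for every disc family and window, EITHER some
closed disc meets `ν` and `N_S{a,b} = N_S{a,b'}`, `N_S{a',b'} = N_S{a',b}` for all `S`, OR none does and
`N_S{a,b} = N_S{a',b}`, `N_S{a',b'} = N_S{a,b'}` for all `S`. -/
theorem patternCount_switch {a a' b b' : UnbasedLoop ℂ} {ν : Set ℂ} (hab : a ≠ b) (hab' : a ≠ b')
    (ha'b : a' ≠ b) (ha'b' : a' ≠ b') (hr : a'.range = a.range ∪ ν)
    (hi : {w | a'.wind w ≠ 0} = {w | a.wind w ≠ 0} \ ν) (hν : ν ⊆ {w | a.wind w ≠ 0} ∪ a.range)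
    (hwin : ∀ R : ℝ, a.range ⊆ ball (0 : ℂ) R → ν ⊆ ball (0 : ℂ) R)
    (hbr : ν ⊆ b.range) (hbi : Disjoint ν {w | b.wind w ≠ 0}) (hb'r : ν ⊆ b'.range)
    (hb'i : Disjoint ν {w | b'.wind w ≠ 0}) {n : ℕ} (x : Fin n → ℂ) (r : Fin n → ℝ) (R : ℝ) :
    (∀ S : Finset (Fin n),
      patternCount (⟨fun j ↦ if j = 0 then {a, b} else ∅⟩ : LoopConfig ℂ) x r R S =
        patternCount (⟨fun j ↦ if j = 0 then {a, b'} else ∅⟩ : LoopConfig ℂ) x r R S ∧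
      patternCount (⟨fun j ↦ if j = 0 then {a', b'} else ∅⟩ : LoopConfig ℂ) x r R S =
        patternCount (⟨fun j ↦ if j = 0 then {a', b} else ∅⟩ : LoopConfig ℂ) x r R S) ∨
    (∀ S : Finset (Fin n),
      patternCount (⟨fun j ↦ if j = 0 then {a, b} else ∅⟩ : LoopConfig ℂ) x r R S =
        patternCount (⟨fun j ↦ if j = 0 then {a', b} else ∅⟩ : LoopConfig ℂ) x r R S ∧
      patternCount (⟨fun j ↦ if j = 0 then {a', b'} else ∅⟩ : LoopConfig ℂ) x r R S =
        patternCount (⟨fun j ↦ if j = 0 then {a, b'} else ∅⟩ : LoopConfig ℂ) x r R S) := by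
  have ha'r : ν ⊆ a'.range := by rw [hr]; exact subset_union_right
  have ha'i : Disjoint ν {w | a'.wind w ≠ 0} := by
    rw [hi]; exact Set.disjoint_left.2 fun w hw h ↦ h.2 hw
  by_cases hmeet : ∃ i, ¬ Disjoint (closedBall (x i) (r i)) ν
  · obtain ⟨i, hi'⟩ := hmeet
    refine Or.inl fun S ↦ ⟨?_, ?_⟩
    · rw [patternCount_pair hab, patternCount_pair hab',
        if_neg (not_patternClauses_of_needle hbr hbi hi' R S),
        if_neg (not_patternClauses_of_needle hb'r hb'i hi' R S)]
    · rw [patternCount_pair ha'b', patternCount_pair ha'b,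
        if_neg (not_patternClauses_of_needle hbr hbi hi' R S),
        if_neg (not_patternClauses_of_needle hb'r hb'i hi' R S)]
  · push Not at hmeet
    have key := fun S ↦ patternClauses_iff_of_needle hr hi hν hwin hmeet R S
    refine Or.inr fun S ↦ ⟨?_, ?_⟩
    · rw [patternCount_pair hab, patternCount_pair ha'b]
      simp only [key S]
    · rw [patternCount_pair ha'b', patternCount_pair hab']
      simp only [key S]

/-! ## §3 Generic distance and measure bookkeeping -/

/-- A point of the trace of `u` at distance `≥ r` from the whole trace of `v` forces `d(u, v) ≥ r`. -/
theorem le_udist_of_forall_le_dist {u v : UnbasedLoop ℂ} {p : ℂ} (hp : p ∈ u.range) {r : ℝ}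
    (h : ∀ y ∈ v.range, r ≤ dist p y) : r ≤ u.udist v :=
  ((Metric.le_infDist v.range_nonempty).2 h).trans (UnbasedLoop.infDist_range_le_udist u v hp)

/-- A loop of type `0` inside the window all of whose candidate partners are `> ε` away witnesses
`¬ d_CN ≤ ε`. -/
theorem not_isClose_of_far {ε : ℝ} {c c' : LoopConfig ℂ} {u : UnbasedLoop ℂ} (hu : u ∈ c.F 0)
    (hur : u.range ⊆ ball (0 : ℂ) (1 / ε)) (hfar : ∀ u' ∈ c'.F 0, ε < u.udist u') :
    ¬ LoopConfig.IsClose ε c c' := by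
  intro h
  obtain ⟨u', hu', hd⟩ := (h 0).1 u hu hur
  exact (hfar u' hu').not_ge hd

/-- Random configurations that are NEVER `ε`-close for `ε ∈ (0, r)`, `r ≤ 1`, have laws at coupling
distance `≥ r` (every coupling charges the sure event, which has mass `1 ≥ ε`). -/
theorem le_cnLawEDist_of_forall_not_isClose {Ω Ω' : Type*} [MeasurableSpace Ω] [MeasurableSpace Ω']
    (P : Measure Ω) (P' : Measure Ω') [IsProbabilityMeasure P] {X : Ω → LoopConfig ℂ}
    {X' : Ω' → LoopConfig ℂ} {r : ℝ} (hr1 : r ≤ 1)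
    (h : ∀ ε : ℝ, 0 < ε → ε < r → ∀ ω ω', ¬ LoopConfig.IsClose ε (X ω) (X' ω')) :
    ENNReal.ofReal r ≤ LoopConfig.cnLawEDist P X P' X' := by
  simp only [LoopConfig.cnLawEDist, le_iInf_iff]
  refine fun ε hε Q h1 _ hQ ↦ ENNReal.ofReal_le_ofReal (not_lt.1 fun hεr ↦ ?_)
  have hQ1 : Q univ = 1 := by
    simpa [Measure.map_apply measurable_fst MeasurableSet.univ] using
      congrArg (fun μ : Measure Ω ↦ μ univ) h1
  rw [show {p : Ω × Ω' | ¬ LoopConfig.IsClose ε (X p.1) (X' p.2)} = univ from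
    eq_univ_of_forall fun p ↦ h ε hε hεr p.1 p.2, hQ1] at hQ
  exact absurd (hQ.trans_le (ENNReal.ofReal_le_one.2 (hεr.le.trans hr1))) (lt_irrefl 1)

/-- The midpoint `1/2` of the unit interval. -/
theorem half_mem_unitInterval : (1 / 2 : ℝ) ∈ unitInterval := ⟨by norm_num, by norm_num⟩

/-- **Volume of a two-piece event on `([0,1], Leb)`**: for propositions `p`, `q`, the set of `s` with
(`s < 1/2` and `p`) or (`s ≥ 1/2` and `q`) has measure `𝟙[p]/2 + 𝟙[q]/2`. -/
theorem volume_setOf_ite_lt_half (p q : Prop) [Decidable p] [Decidable q] :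
    volume {s : unitInterval | if s < ⟨1 / 2, half_mem_unitInterval⟩ then p else q} =
      (if p then ENNReal.ofReal (1 / 2) else 0) + (if q then ENNReal.ofReal (1 / 2) else 0) := by
  set h : unitInterval := ⟨1 / 2, half_mem_unitInterval⟩ with hh
  by_cases hp : p <;> by_cases hq : q
  · rw [if_pos hp, if_pos hq, show {s : unitInterval | if s < h then p else q} = univ from
      eq_univ_of_forall fun s ↦ by by_cases hs : s < h <;> simp [hp, hq], measure_univ,
      ← ENNReal.ofReal_add (by norm_num) (by norm_num)]
    norm_num
  · rw [if_pos hp, if_neg hq, add_zero, show {s : unitInterval | if s < h then p else q} = Iio h from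
      Set.ext fun s ↦ by by_cases hs : s < h <;> simp [hs, hp, hq], unitInterval.volume_Iio]
  · rw [if_neg hp, if_pos hq, zero_add, show {s : unitInterval | if s < h then p else q} = Ici h from
      Set.ext fun s ↦ by simp [hp, hq], unitInterval.volume_Ici]
    norm_num [hh]
  · rw [if_neg hp, if_neg hq, add_zero, show {s : unitInterval | if s < h then p else q} = ∅ from
      Set.eq_empty_of_forall_notMem fun s hs ↦ by simp [hp, hq] at hs,
      measure_empty]

end Summit.CriticalPhenomena.CardyFormulaZ2.Cruxes.NestingRigidity.PositiveConeWeightDoubling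

end
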